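import Summits.QuantumFields.YangMills.Theorems.VirialFluxGapDeficitForm
import Summits.QuantumFields.YangMills.Theorems.LuscherReductionTwistedTraceScalingCombFlat
import Summits.QuantumFields.YangMills.Theorems.LuscherReductionTwistedTraceScalingLatticeHS
import Summits.QuantumFields.YangMills.Theorems.ToronSmallBallOwnAxisShiftLocal
import Literature.MathematicalPhysics.QuantumFieldTheory.Balaban1983to89.T4HaarSU2Translate
import HarnessLib

/-!
# The periodic toron log-floor, I: the zero-flux ring deficit is `O_L(1/β)` on the comb-flat toron event

Brick (A) of the seat memo `SWAP-STRATA-23802-w2g54.md` (evidence #2 on ⟨stmt-QuantumFields-23802⟩ `SwapTwistDeficit.TwistRatioVanishesFixedL`):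
the periodic LOG-FLOOR `W_0(β) ≳_L e^{12βL⁴} β^{−(9L⁴−3/2)} log β` of the zero-flux `2L`-slice ring.  This file is the ACTION half:
a ring history `p = (U⃗, g)` on `(ℤ/L)³ × ℤ/(2L)` all of whose slices are linkwise within `τ` (chordal Frobenius distance ✓`fd`) of the
COMB-FLAT configuration ✓`combFlat h` (every link `1` except the wrap links `x_k = −1` of direction `k`, which carry the letter `h k`), whose seam
field `g` is sitewise within `τ` of a fourth letter `C`, and whose four letters pairwise almost commute, `‖q(a)q(b) − q(b)q(a)‖ ≤ t` for the unit
quaternions `q = su2Quat`, has zero-flux deficit `F_0(p) = ringDeficit L 0 p ≤ 6L⁴·(4τ + 2t)²`: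
* §1 chordal bookkeeping: `2 − Re tr(UV⁻¹) = fd(U,V)²/2`, the four-letter plaquette-word perturbation, the three-letter seam-word perturbation,
  `fd(ab, ba) ≤ √2·‖q(a)q(b) − q(b)q(a)‖`;
* §2 `fd_plaquetteHolonomy_combFlat_le` — a plaquette of `combFlat h` is `1` or a commutator of two letters;
* §3 `wilsonAction_le_of_near_combFlat` (uses ✓`card_plaquette_three`), `slab_le` (one bond `6L³ − log K_1(U,V) ≤ 3L³η²/2 + A`);
* §4 ★ `ringDeficit_le_of_toronEvent` — the bound `F_0(p) ≤ 6L⁴(4τ + 2t)²`.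
HONEST LABEL: deterministic bookkeeping on one ring history; nothing about ⟨23802⟩/⟨24196⟩ or any rung is proved; the Yang–Mills mass gap
is NOT proved; no summit is proved by a line.  THEOREMS ONLY (0 `def`, 0 `sorry`), standard axioms.  Width seat ym-line-sfw-p2-w2 g54
(cell ym-idea-1, free hands; `--supports stmt-QuantumFields-23802`).  References: [cite: Luscher1983, §2]; [cite: Vanbaal2001]; [folklore].
-/

set_option autoImplicit false

noncomputable section

open scoped Matrix BigOperators Quaternion
open Literature.MathematicalPhysics.QuantumFieldTheory hiding SU2
open Literature.MathematicalPhysics.QuantumLattice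
open Summit.QuantumFields.YangMills.Theorems.FemtoTransferGap
open Summit.QuantumFields.YangMills.Theorems.FemtoTransferGap.TT
open Summit.QuantumFields.YangMills.Theorems.FemtoTransferGap.TwoLattice.Flat
open Summit.QuantumFields.YangMills.Theorems.VirialFluxGap.RingDeficit

namespace Summit.QuantumFields.YangMills.Theorems.SwapTwistDeficit.ToronFloor

variable {L : ℕ} [NeZero L]

/-! ## §1 Chordal bookkeeping -/

omit [NeZero L] in
/-- The time-like link deficit is half the squared chordal distance: `2 − Re tr(U V⁻¹) = fd(U,V)²/2`. [folklore] -/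
theorem two_sub_re_trace_mul_inv_eq (U V : SU2) :
    2 - ((su2Rep (U * V⁻¹)).trace).re = fd U V ^ 2 / 2 := by
  rw [fundamentalRep_apply, two_sub_re_trace_eq, ← frobNorm_sub_eq_mul_inv]
  rfl

omit [NeZero L] in
/-- Perturbing all four letters of a plaquette word `A X C⁻¹ B⁻¹`. [folklore] -/
theorem fd_word4_le (A X C B A' X' C' B' : SU2) :
    fd (A * X * C⁻¹ * B⁻¹) (A' * X' * C'⁻¹ * B'⁻¹) ≤ fd A A' + fd X X' + fd C C' + fd B B' := by
  have h1 : fd (A * X * C⁻¹ * B⁻¹) (A * X' * C⁻¹ * B⁻¹) = fd X X' := by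
    rw [show A * X * C⁻¹ * B⁻¹ = A * (X * (C⁻¹ * B⁻¹)) by group, show A * X' * C⁻¹ * B⁻¹ = A * (X' * (C⁻¹ * B⁻¹)) by group,
      fd_mul_left, fd_mul_right]
  have h2 := fd_word_le A X' C B A' C' B'
  calc fd (A * X * C⁻¹ * B⁻¹) (A' * X' * C'⁻¹ * B'⁻¹)
      ≤ fd (A * X * C⁻¹ * B⁻¹) (A * X' * C⁻¹ * B⁻¹) + fd (A * X' * C⁻¹ * B⁻¹) (A' * X' * C'⁻¹ * B'⁻¹) := fd_triangle _ _ _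
    _ ≤ fd X X' + (fd A A' + fd C C' + fd B B') := by rw [h1]; exact add_le_add le_rfl h2
    _ = fd A A' + fd X X' + fd C C' + fd B B' := by ring

omit [NeZero L] in
/-- Perturbing the three letters of a seam word `A X B⁻¹`. [folklore] -/
theorem fd_word3_le (A X B A' X' B' : SU2) :
    fd (A * X * B⁻¹) (A' * X' * B'⁻¹) ≤ fd A A' + fd X X' + fd B B' := by
  have h1 : fd (A * X * B⁻¹) (A' * X * B⁻¹) = fd A A' := by
    rw [show A * X * B⁻¹ = A * (X * B⁻¹) by group, show A' * X * B⁻¹ = A' * (X * B⁻¹) by group, fd_mul_right]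
  have h2 : fd (A' * X * B⁻¹) (A' * X' * B⁻¹) = fd X X' := by
    rw [show A' * X * B⁻¹ = A' * X * B⁻¹ by rfl, mul_assoc, mul_assoc, fd_mul_left, fd_mul_right]
  have h3 : fd (A' * X' * B⁻¹) (A' * X' * B'⁻¹) = fd B B' := by
    rw [fd_mul_left, fd_inv]
  calc fd (A * X * B⁻¹) (A' * X' * B'⁻¹)
      ≤ fd (A * X * B⁻¹) (A' * X * B⁻¹) + fd (A' * X * B⁻¹) (A' * X' * B'⁻¹) := fd_triangle _ _ _
    _ ≤ fd A A' + (fd (A' * X * B⁻¹) (A' * X' * B⁻¹) + fd (A' * X' * B⁻¹) (A' * X' * B'⁻¹)) := by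
        rw [h1]; exact add_le_add le_rfl (fd_triangle _ _ _)
    _ = fd A A' + fd X X' + fd B B' := by rw [h2, h3]; ring

omit [NeZero L] in
/-- `fd(a b a⁻¹ b⁻¹, 1) = fd(ab, ba)`. [folklore] -/
theorem fd_comm_word_one (a b : SU2) : fd (a * b * a⁻¹ * b⁻¹) 1 = fd (a * b) (b * a) := by
  rw [← fd_mul_right (b * a) (a * b * a⁻¹ * b⁻¹) 1, one_mul]
  congr 1
  group

omit [NeZero L] in
/-- `fd(c a c⁻¹, a) = fd(c a, a c)`. [folklore] -/
theorem fd_conj_eq (c a : SU2) : fd (c * a * c⁻¹) a = fd (c * a) (a * c) := by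
  rw [← fd_mul_right c (c * a * c⁻¹) a, inv_mul_cancel_right]

omit [NeZero L] in
/-- **Almost commuting letters**: `fd(ab, ba) ≤ √2·‖q(a)q(b) − q(b)q(a)‖` (`q = su2Quat`; in fact equality). [folklore] -/
theorem fd_mul_comm_le (a b : SU2) : fd (a * b) (b * a) ≤ Real.sqrt 2 * ‖su2Quat a * su2Quat b - su2Quat b * su2Quat a‖ := by
  have h := OwnAxis.norm_su2Quat_sub_sq_eq (a * b) (b * a)
  rw [Literature.MathematicalPhysics.QuantumFieldTheory.Balaban1983to89.T4HaarSU2Translate.su2Quat_mul,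
    Literature.MathematicalPhysics.QuantumFieldTheory.Balaban1983to89.T4HaarSU2Translate.su2Quat_mul] at h
  have hfd : 0 ≤ fd (a * b) (b * a) := frobNorm_nonneg _
  have hn : 0 ≤ ‖su2Quat a * su2Quat b - su2Quat b * su2Quat a‖ := norm_nonneg _
  have hsq : fd (a * b) (b * a) ^ 2 = (Real.sqrt 2 * ‖su2Quat a * su2Quat b - su2Quat b * su2Quat a‖) ^ 2 := by
    rw [mul_pow, Real.sq_sqrt (by norm_num : (0 : ℝ) ≤ 2)]
    unfold fd
    linarith
  have h2 : 0 ≤ Real.sqrt 2 * ‖su2Quat a * su2Quat b - su2Quat b * su2Quat a‖ := by positivity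
  exact le_of_eq ((pow_left_inj₀ hfd h2 two_ne_zero).1 hsq)

/-! ## §2 Plaquettes of the comb-flat configuration -/

omit [NeZero L] in
/-- Shifting in direction `i` does not change the `j`-coordinate (`j ≠ i`). [folklore] -/
theorem shift_apply_of_ne {x : Site 3 L} {i j : Fin 3} (h : j ≠ i) : (x.shift i) j = x j := by
  rw [Site.shift, Pi.add_apply, Pi.single_apply, if_neg h, add_zero]

omit [NeZero L] in
/-- **A plaquette of `combFlat h` is `1` or the commutator of two letters**: `fd(hol, 1) ≤ fd(h_i h_j, h_j h_i)` for `i ≠ j`. [cite: Luscher1983, §2] -/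
theorem fd_plaquetteHolonomy_combFlat_le (h : Fin 3 → SU2) (x : Site 3 L) {i j : Fin 3} (hij : i ≠ j) :
    fd (plaquetteHolonomy (combFlat (L := L) h) x i j) 1 ≤ fd (h i * h j) (h j * h i) := by
  have hfd0 : 0 ≤ fd (h i * h j) (h j * h i) := frobNorm_nonneg _
  simp only [plaquetteHolonomy, combFlat_apply]
  rw [shift_apply_of_ne (Ne.symm hij), shift_apply_of_ne hij]
  by_cases hi : x i = -1 <;> by_cases hj : x j = -1 <;> simp only [hi, hj, if_true, if_false]
  · rw [fd_comm_word_one]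
  · rw [inv_one, mul_one, mul_one, mul_inv_cancel, fd_self]; exact hfd0
  · rw [one_mul, inv_one, mul_one, mul_inv_cancel, fd_self]; exact hfd0
  · rw [inv_one, mul_one, mul_one, mul_one, fd_self]; exact hfd0

/-! ## §3 The Wilson action and one bond near the comb-flat configuration -/

/-- The Wilson action as half the sum of squared chordal plaquette deficits. [folklore] -/
theorem wilsonAction_eq_sum_fd_sq (U : GaugeConfig 3 L SU2) :
    wilsonAction su2Rep U = ∑ p : Plaquette 3 L, fd (plaquetteHolonomy U p.1 p.2.1.1 p.2.1.2) 1 ^ 2 / 2 := by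
  unfold wilsonAction
  refine Finset.sum_congr rfl fun p _ => ?_
  rw [fundamentalRep_apply, fd_one]
  have := two_sub_re_trace_eq (plaquetteHolonomy U p.1 p.2.1.1 p.2.1.2)
  push_cast
  linarith

/-- **Wilson action near the comb-flat configuration**: if every link of `U` is within `τ` of `combFlat h` and the letters almost commute
(`fd(h_i h_j, h_j h_i) ≤ s`), then `S(U) ≤ 3L³·(4τ + s)²/2`. [cite: Luscher1983, §2] -/
theorem wilsonAction_le_of_near_combFlat {h : Fin 3 → SU2} {τ s : ℝ} (hs : ∀ i j : Fin 3, i ≠ j → fd (h i * h j) (h j * h i) ≤ s)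
    {U : GaugeConfig 3 L SU2} (hU : ∀ e, fd (U e) (combFlat h e) ≤ τ) :
    wilsonAction su2Rep U ≤ 3 * (L : ℝ) ^ 3 * ((4 * τ + s) ^ 2 / 2) := by
  have hs0 : 0 ≤ s := le_trans (frobNorm_nonneg _) (hs 0 1 (by decide))
  have hp : ∀ p : Plaquette 3 L, fd (plaquetteHolonomy U p.1 p.2.1.1 p.2.1.2) 1 ≤ 4 * τ + s := by
    rintro ⟨x, ⟨⟨i, j⟩, hij⟩⟩
    have hne : i ≠ j := ne_of_lt hij
    calc fd (plaquetteHolonomy U x i j) 1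
        ≤ fd (plaquetteHolonomy U x i j) (plaquetteHolonomy (combFlat h) x i j) + fd (plaquetteHolonomy (combFlat h) x i j) 1 :=
          fd_triangle _ _ _
      _ ≤ (fd (U (x, i)) (combFlat h (x, i)) + fd (U (x.shift i, j)) (combFlat h (x.shift i, j)) +
            fd (U (x.shift j, i)) (combFlat h (x.shift j, i)) + fd (U (x, j)) (combFlat h (x, j))) + fd (h i * h j) (h j * h i) :=
          add_le_add (fd_word4_le _ _ _ _ _ _ _ _) (fd_plaquetteHolonomy_combFlat_le h x hne)
      _ ≤ (τ + τ + τ + τ) + s := add_le_add (by linarith [hU (x, i), hU (x.shift i, j), hU (x.shift j, i), hU (x, j)]) (hs i j hne)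
      _ = 4 * τ + s := by ring
  rw [wilsonAction_eq_sum_fd_sq]
  calc ∑ p : Plaquette 3 L, fd (plaquetteHolonomy U p.1 p.2.1.1 p.2.1.2) 1 ^ 2 / 2
      ≤ ∑ _p : Plaquette 3 L, (4 * τ + s) ^ 2 / 2 := Finset.sum_le_sum fun p _ => by
        have h0 : 0 ≤ fd (plaquetteHolonomy U p.1 p.2.1.1 p.2.1.2) 1 := frobNorm_nonneg _
        have := pow_le_pow_left₀ h0 (hp p) 2
        linarith
    _ = 3 * (L : ℝ) ^ 3 * ((4 * τ + s) ^ 2 / 2) := by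
        rw [Finset.sum_const, Finset.card_univ, card_plaquette_three, nsmul_eq_mul]; push_cast; ring

/-- **One bond**: if every link of `U` is within `η` of the corresponding link of `V` and both Wilson actions are `≤ A`, then
`6L³ − log K_1(U,V) ≤ 3L³η²/2 + A`. [cite: Luscher1983, §2] -/
theorem slab_le {U V : GaugeConfig 3 L SU2} {η A : ℝ} (hUV : ∀ e, fd (U e) (V e) ≤ η)
    (hSU : wilsonAction su2Rep U ≤ A) (hSV : wilsonAction su2Rep V ≤ A) :
    6 * (L : ℝ) ^ 3 - Real.log (transferKernel su2Rep 1 U V) ≤ 3 * (L : ℝ) ^ 3 * (η ^ 2 / 2) + A := by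
  rw [SectorSmooth.log_transferKernel_one]
  have htc : 6 * (L : ℝ) ^ 3 - timeCoupling su2Rep U V ≤ 3 * (L : ℝ) ^ 3 * (η ^ 2 / 2) := by
    unfold timeCoupling
    have e : 6 * (L : ℝ) ^ 3 - ∑ e : Edge 3 L, ((su2Rep (U e * (V e)⁻¹)).trace).re =
        ∑ e : Edge 3 L, (2 - ((su2Rep (U e * (V e)⁻¹)).trace).re) := by
      rw [Finset.sum_sub_distrib, Finset.sum_const, Finset.card_univ, card_edge_three, nsmul_eq_mul]; push_cast; ring
    rw [e]
    calc ∑ e : Edge 3 L, (2 - ((su2Rep (U e * (V e)⁻¹)).trace).re) = ∑ e : Edge 3 L, fd (U e) (V e) ^ 2 / 2 :=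
          Finset.sum_congr rfl fun e _ => two_sub_re_trace_mul_inv_eq _ _
      _ ≤ ∑ _e : Edge 3 L, η ^ 2 / 2 := Finset.sum_le_sum fun e _ => by
          have h0 : 0 ≤ fd (U e) (V e) := frobNorm_nonneg _
          have := pow_le_pow_left₀ h0 (hUV e) 2
          linarith
      _ = 3 * (L : ℝ) ^ 3 * (η ^ 2 / 2) := by
          rw [Finset.sum_const, Finset.card_univ, card_edge_three, nsmul_eq_mul]; push_cast; ring
  linarith

/-! ## §4 The ring deficit on the toron event -/

omit [NeZero L] in
/-- The zero twist does nothing. [folklore] -/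
theorem twist3_false (U : GaugeConfig 3 L SU2) : twist3 (fun _ => false) U = U := by
  simp [twist3, centreElem]

/-- ★ **The zero-flux ring deficit on the toron event.**  Let `h : Fin 3 → SU(2)` and `C ∈ SU(2)` be four letters that pairwise almost
commute, `‖q(a)q(b) − q(b)q(a)‖ ≤ t`; let every slice of the ring history `p` be linkwise within `τ` of `combFlat h` and its seam field
sitewise within `τ` of `C`.  Then `F_0(p) = ringDeficit L 0 p ≤ 6L⁴·(4τ + 2t)²`. [cite: Luscher1983, §2] [cite: Vanbaal2001] -/
theorem ringDeficit_le_of_toronEvent {h : Fin 3 → SU2} {C : SU2} {t τ : ℝ} (ht : 0 ≤ t) (hτ : 0 ≤ τ)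
    (hhh : ∀ i j : Fin 3, ‖su2Quat (h i) * su2Quat (h j) - su2Quat (h j) * su2Quat (h i)‖ ≤ t)
    (hhC : ∀ i : Fin 3, ‖su2Quat (h i) * su2Quat C - su2Quat C * su2Quat (h i)‖ ≤ t)
    {p : (Fin (2 * L - 1 + 1) → GaugeConfig 3 L SU2) × (Site 3 L → SU2)}
    (hslice : ∀ j e, fd (p.1 j e) (combFlat h e) ≤ τ) (hseam : ∀ x, fd (p.2 x) C ≤ τ) :
    ringDeficit L (fun _ => false) p ≤ 6 * (L : ℝ) ^ 4 * (4 * τ + 2 * t) ^ 2 := by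
  have hL1 : 1 ≤ L := NeZero.one_le
  have h2 : Real.sqrt 2 ≤ 2 := by
    rw [show (2 : ℝ) = Real.sqrt 4 by rw [show (4 : ℝ) = 2 ^ 2 by norm_num, Real.sqrt_sq (by norm_num)]]
    exact Real.sqrt_le_sqrt (by norm_num)
  -- letters: `fd(h_i h_j, h_j h_i) ≤ 2t`, `fd(h_i C, C h_i) ≤ 2t`
  have hs : ∀ i j : Fin 3, i ≠ j → fd (h i * h j) (h j * h i) ≤ 2 * t := fun i j _ =>
    (fd_mul_comm_le _ _).trans (by nlinarith [hhh i j, norm_nonneg (su2Quat (h i) * su2Quat (h j) - su2Quat (h j) * su2Quat (h i))])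
  have hsC : ∀ i : Fin 3, fd (h i * C) (C * h i) ≤ 2 * t := fun i =>
    (fd_mul_comm_le _ _).trans (by nlinarith [hhC i, norm_nonneg (su2Quat (h i) * su2Quat C - su2Quat C * su2Quat (h i))])
  set η : ℝ := 4 * τ + 2 * t with hηdef
  have hη : 0 ≤ η := by positivity
  set A : ℝ := 3 * (L : ℝ) ^ 3 * ((4 * τ + 2 * t) ^ 2 / 2) with hAdef
  -- every slice has small action
  have hS : ∀ j, wilsonAction su2Rep (p.1 j) ≤ A := fun j => wilsonAction_le_of_near_combFlat hs (hslice j)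
  -- consecutive slices are linkwise `2τ ≤ η` close
  have hlink : ∀ j j' e, fd (p.1 j e) (p.1 j' e) ≤ η := by
    intro j j' e
    calc fd (p.1 j e) (p.1 j' e) ≤ fd (p.1 j e) (combFlat h e) + fd (combFlat h e) (p.1 j' e) := fd_triangle _ _ _
      _ ≤ τ + τ := add_le_add (hslice j e) (by rw [fd_comm]; exact hslice j' e)
      _ ≤ η := by rw [hηdef]; linarith
  -- the seam bond: `U_last` versus `g · U_0`
  have hconj : ∀ e : Edge 3 L, fd (C * combFlat (L := L) h e * C⁻¹) (combFlat (L := L) h e) ≤ 2 * t := by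
    intro e
    rw [fd_conj_eq, combFlat_apply]
    by_cases hx : e.1 e.2 = -1
    · rw [if_pos hx, fd_comm]; exact hsC e.2
    · rw [if_neg hx, mul_one, one_mul, fd_self]; positivity
  have hseamlink : ∀ e, fd (p.1 (Fin.last (2 * L - 1)) e) (gaugeTransform p.2 (p.1 0) e) ≤ η := by
    intro e
    have hg : gaugeTransform p.2 (p.1 0) e = p.2 e.1 * p.1 0 e * (p.2 (e.1.shift e.2))⁻¹ := rfl
    rw [hg]
    calc fd (p.1 (Fin.last (2 * L - 1)) e) (p.2 e.1 * p.1 0 e * (p.2 (e.1.shift e.2))⁻¹)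
        ≤ fd (p.1 (Fin.last (2 * L - 1)) e) (combFlat h e) + fd (combFlat h e) (p.2 e.1 * p.1 0 e * (p.2 (e.1.shift e.2))⁻¹) :=
          fd_triangle _ _ _
      _ ≤ τ + (fd (combFlat h e) (C * combFlat h e * C⁻¹) + fd (C * combFlat h e * C⁻¹) (p.2 e.1 * p.1 0 e * (p.2 (e.1.shift e.2))⁻¹)) :=
          add_le_add (hslice _ e) (fd_triangle _ _ _)
      _ ≤ τ + (2 * t + (τ + τ + τ)) := by
          refine add_le_add le_rfl (add_le_add ?_ ?_)
          · rw [fd_comm]; exact hconj e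
          · calc fd (C * combFlat h e * C⁻¹) (p.2 e.1 * p.1 0 e * (p.2 (e.1.shift e.2))⁻¹)
                ≤ fd C (p.2 e.1) + fd (combFlat h e) (p.1 0 e) + fd C (p.2 (e.1.shift e.2)) := fd_word3_le _ _ _ _ _ _
              _ ≤ τ + τ + τ := by
                  refine add_le_add (add_le_add ?_ ?_) ?_
                  · rw [fd_comm]; exact hseam _
                  · rw [fd_comm]; exact hslice 0 e
                  · rw [fd_comm]; exact hseam _
      _ = η := by rw [hηdef]; ring
  have hSseam : wilsonAction su2Rep (gaugeTransform p.2 (p.1 0)) ≤ A := by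
    rw [wilsonAction_gaugeTransform]; exact hS 0
  -- each of the `2L` bonds costs at most `3L³η²/2 + A = 3L³η²`
  have hbond : ∀ i : Fin (2 * L - 1),
      6 * (L : ℝ) ^ 3 - Real.log (transferKernel su2Rep 1 (p.1 i.castSucc) (p.1 i.succ)) ≤ 3 * (L : ℝ) ^ 3 * (η ^ 2 / 2) + A :=
    fun i => slab_le (hlink _ _) (hS _) (hS _)
  have hbondseam : 6 * (L : ℝ) ^ 3 -
      Real.log (transferKernel su2Rep 1 (p.1 (Fin.last (2 * L - 1))) (gaugeTransform p.2 (twist3 (fun _ => false) (p.1 0)))) ≤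
        3 * (L : ℝ) ^ 3 * (η ^ 2 / 2) + A := by
    rw [twist3_false]
    exact slab_le hseamlink (hS _) hSseam
  -- sum over the bonds
  unfold ringDeficit
  rw [ringExponent_eq, SectorSmooth.log_seamChain_one]
  have hn : (((2 * L - 1 : ℕ) : ℝ)) = 2 * (L : ℝ) - 1 := by
    rw [Nat.cast_sub (by omega), Nat.cast_mul]; push_cast; ring
  have hsum : (∑ i : Fin (2 * L - 1), (6 * (L : ℝ) ^ 3 - Real.log (transferKernel su2Rep 1 (p.1 i.castSucc) (p.1 i.succ)))) ≤
      ((2 * L - 1 : ℕ) : ℝ) * (3 * (L : ℝ) ^ 3 * (η ^ 2 / 2) + A) := by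
    calc (∑ i : Fin (2 * L - 1), (6 * (L : ℝ) ^ 3 - Real.log (transferKernel su2Rep 1 (p.1 i.castSucc) (p.1 i.succ))))
        ≤ ∑ _i : Fin (2 * L - 1), (3 * (L : ℝ) ^ 3 * (η ^ 2 / 2) + A) := Finset.sum_le_sum fun i _ => hbond i
      _ = ((2 * L - 1 : ℕ) : ℝ) * (3 * (L : ℝ) ^ 3 * (η ^ 2 / 2) + A) := by
          rw [Finset.sum_const, Finset.card_univ, Fintype.card_fin, nsmul_eq_mul]
  have hsplit : 12 * (L : ℝ) ^ 4 - ((∑ i : Fin (2 * L - 1), Real.log (transferKernel su2Rep 1 (p.1 i.castSucc) (p.1 i.succ))) +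
      Real.log (transferKernel su2Rep 1 (p.1 (Fin.last (2 * L - 1))) (gaugeTransform p.2 (twist3 (fun _ => false) (p.1 0))))) =
      (∑ i : Fin (2 * L - 1), (6 * (L : ℝ) ^ 3 - Real.log (transferKernel su2Rep 1 (p.1 i.castSucc) (p.1 i.succ)))) +
        (6 * (L : ℝ) ^ 3 -
          Real.log (transferKernel su2Rep 1 (p.1 (Fin.last (2 * L - 1))) (gaugeTransform p.2 (twist3 (fun _ => false) (p.1 0))))) := by
    rw [Finset.sum_sub_distrib, Finset.sum_const, Finset.card_univ, Fintype.card_fin, nsmul_eq_mul, hn]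
    ring
  rw [hsplit]
  calc (∑ i : Fin (2 * L - 1), (6 * (L : ℝ) ^ 3 - Real.log (transferKernel su2Rep 1 (p.1 i.castSucc) (p.1 i.succ)))) +
        (6 * (L : ℝ) ^ 3 -
          Real.log (transferKernel su2Rep 1 (p.1 (Fin.last (2 * L - 1))) (gaugeTransform p.2 (twist3 (fun _ => false) (p.1 0)))))
      ≤ ((2 * L - 1 : ℕ) : ℝ) * (3 * (L : ℝ) ^ 3 * (η ^ 2 / 2) + A) + (3 * (L : ℝ) ^ 3 * (η ^ 2 / 2) + A) := add_le_add hsum hbondseam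
    _ = 6 * (L : ℝ) ^ 4 * (4 * τ + 2 * t) ^ 2 := by rw [hn, hAdef, hηdef]; ring

end Summit.QuantumFields.YangMills.Theorems.SwapTwistDeficit.ToronFloor

end
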